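import Summits.AtomisticToContinuum.FouriersLaw.Theorems.ParityLiouvilleSeedLiouvilleForHeatHarmonicBoxDefs
import Summits.AtomisticToContinuum.FouriersLaw.Theorems.ParityLiouvilleSeedLiouvilleForHeatHarmonicGaussIBP
import Summits.AtomisticToContinuum.FouriersLaw.Theorems.ParityLiouvilleSeedLiouvilleForHeatHarmonicCovariance

/-!
# The Gaussian coupling of a box marginal of the radiating state

Helper file for the REGULARITY part of the harmonic tightness witness of
`ParityLiouvilleSeed.LiouvilleForHeat` (`stmt-AtomisticToContinuum-13980`); objects in
`ParityLiouvilleSeedLiouvilleForHeatHarmonicBoxDefs`.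

* `cplField_cplRestrict` — on the noise, the coupling field map IS the box of the field:
  `cplField a n (cplRestrict a n ζ) = box_{a,n} (gaussField ζ)`;
* `noiseMeasure_map_cplRestrict` — the law of the coupling coordinates is the product Gaussian
  `cplMeasure ω₂ n` (independence of disjoint blocks of the white noise, via a flat re-indexing and
  `Measure.map_infinitePi_infinitePi_of_inj`);
* `lintegral_cplField_mul` — **Lebesgue integrals on the box phase space are shear integrals on the
  coupling space**: `∫⁻ F(cplField w) Φ(u) dw = (∫⁻ F dx) (∫⁻ Φ du)` (translation invariance of
  Lebesgue measure in the momentum block, Tonelli, `arrowProdEquivProdArrow`);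
* `cplMeasure_eq_withDensity` — the density of the coupling law with respect to Lebesgue measure.
-/

noncomputable section

open MeasureTheory ProbabilityTheory
open scoped NNReal ENNReal
open Literature.MathematicalPhysics.KineticTheory.HeatConduction

namespace Summit.AtomisticToContinuum.FouriersLaw.Theorems.ParityLiouvilleSeed.HarmonicWitness

variable (ω₂ : ℝ) (a : ℤ) (n : ℕ)

/-! ### The extra coordinates -/

/-- The extra coordinates are position-type (`ξ`) or `ζ'` noises, never momentum noise. [folklore] -/
theorem extraIdx_snd_ne_one (j : Fin (n + 5)) : (extraIdx a n j).2 ≠ 1 := by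
  unfold extraIdx
  split_ifs <;> simp

/-- Hence the extra coordinates have unit variance. [folklore] -/
@[simp] theorem noiseVar_extraIdx (j : Fin (n + 5)) : noiseVar ω₂ (extraIdx a n j).2 = 1 := by
  unfold extraIdx
  split_ifs <;> simp [noiseVar]

/-- The enumeration of the extra coordinates is injective. [folklore] -/
theorem extraIdx_injective : Function.Injective (extraIdx a n) := by
  intro j k h
  unfold extraIdx at h
  apply Fin.ext
  split_ifs at h with h1 h2 h3 h4 h5 h6 h7 h8 <;> simp only [Prod.mk.injEq] at h <;> omega

/-- `ξ_x` read off the coupling coordinates of a noise configuration (`a-1 ≤ x ≤ a+n+1`). [folklore] -/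
theorem cplXi_cplRestrict (ζ : Src) (x : ℤ) (hx : a - 1 ≤ x ∧ x ≤ a + n + 1) :
    cplXi a n (cplRestrict a n ζ).1 x = ζ (x, 0) := by
  unfold cplXi
  split_ifs with h1 h2 h3
  · rw [cplRestrict_fst_fst]
    congr 2
    simp only
    omega
  · rw [cplRestrict_fst_snd, h2]
    rfl
  · rw [cplRestrict_fst_snd, h3]
    unfold extraIdx
    simp
  · exfalso; omega

/-- `ζ'_x` read off the coupling coordinates of a noise configuration (`a-2 ≤ x ≤ a+n`). [folklore] -/
theorem cplZe_cplRestrict (ζ : Src) (x : ℤ) (hx : a - 2 ≤ x ∧ x ≤ a + n) :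
    cplZe a n (cplRestrict a n ζ).1 x = ζ (x, 2) := by
  unfold cplZe
  rw [dif_pos hx, cplRestrict_fst_snd]
  unfold extraIdx
  have h0 : ¬ ((⟨(x - a + 4).toNat, by omega⟩ : Fin (n + 5)).val = 0) := by simp only; omega
  have h1 : ¬ ((⟨(x - a + 4).toNat, by omega⟩ : Fin (n + 5)).val = 1) := by simp only; omega
  rw [if_neg h0, if_neg h1]
  congr 2
  simp only
  omega

/-- **The coupling field map on the noise is the box of the field.** [folklore] -/
theorem cplField_cplRestrict (ζ : Src) : cplField a n (cplRestrict a n ζ) = boxRestrictAt a n (gaussField ζ) := by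
  funext i
  have hi := i.2
  refine Prod.ext rfl ?_
  rw [cplField_apply_snd, cplRestrict_snd, boxRestrictAt_apply, gaussField_apply_snd, cplShift,
    cplXi_cplRestrict a n ζ _ (by constructor <;> omega), cplXi_cplRestrict a n ζ _ (by constructor <;> omega),
    cplZe_cplRestrict a n ζ _ (by constructor <;> omega), cplZe_cplRestrict a n ζ _ (by constructor <;> omega),
    cplZe_cplRestrict a n ζ _ (by constructor <;> omega), gaussFieldP]
  have e1 : a + (i : ℤ) - 1 = a + i - 1 := rfl
  ring_nf

/-! ### The law of the coupling coordinates -/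

/-- The flat enumeration of all coupling coordinates, `((ξ_Λ ⊕ extras) ⊕ η_Λ) → Idx`, is injective.
[folklore] -/
theorem flatIdx_injective :
    Function.Injective (Sum.elim (Sum.elim (fun i : Fin (n + 1) => ((a + i : ℤ), (0 : Fin 3))) (extraIdx a n))
      (fun i : Fin (n + 1) => ((a + i : ℤ), (1 : Fin 3)))) := by
  have hQ : Function.Injective fun i : Fin (n + 1) => ((a + i : ℤ), (0 : Fin 3)) := by
    intro i k h
    simp only [Prod.mk.injEq, add_right_inj, Nat.cast_inj, and_true] at h
    exact Fin.ext h
  have hP : Function.Injective fun i : Fin (n + 1) => ((a + i : ℤ), (1 : Fin 3)) := by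
    intro i k h
    simp only [Prod.mk.injEq, add_right_inj, Nat.cast_inj, and_true] at h
    exact Fin.ext h
  have hQE : ∀ (i : Fin (n + 1)) (j : Fin (n + 5)), ((a + i : ℤ), (0 : Fin 3)) ≠ extraIdx a n j := by
    intro i j h
    have hi := i.2
    unfold extraIdx at h
    split_ifs at h with h1 h2
    · simp only [Prod.mk.injEq] at h; omega
    · simp only [Prod.mk.injEq] at h; omega
    · simp only [Prod.mk.injEq] at h; exact absurd h.2 (by decide)
  refine (hQ.sumElim (extraIdx_injective a n) hQE).sumElim hP ?_
  rintro (i | j) k h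
  · simp only [Sum.elim_inl, Prod.mk.injEq] at h
    exact absurd h.2 (by decide)
  · simp only [Sum.elim_inr] at h
    exact extraIdx_snd_ne_one a n j (by rw [h])

/-- **The law of the coupling coordinates under the noise is the coupling law.** [folklore] -/
theorem noiseMeasure_map_cplRestrict : (noiseMeasure ω₂).map (cplRestrict a n) = cplMeasure ω₂ n := by
  classical
  set ι : (Fin (n + 1) ⊕ Fin (n + 5)) ⊕ Fin (n + 1) → Idx :=
    Sum.elim (Sum.elim (fun i : Fin (n + 1) => ((a + i : ℤ), (0 : Fin 3))) (extraIdx a n))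
      (fun i : Fin (n + 1) => ((a + i : ℤ), (1 : Fin 3))) with hι
  set μJ : (Fin (n + 1) ⊕ Fin (n + 5)) ⊕ Fin (n + 1) → Measure ℝ := fun j => gaussianReal 0 (noiseVar ω₂ (ι j).2)
    with hμJ
  -- the flat restriction and the regrouping equivalence
  set e : ((Fin (n + 1) ⊕ Fin (n + 5)) ⊕ Fin (n + 1) → ℝ) → Cpl n :=
    Prod.map (MeasurableEquiv.sumPiEquivProdPi fun _ : Fin (n + 1) ⊕ Fin (n + 5) => ℝ) id ∘
      MeasurableEquiv.sumPiEquivProdPi (fun _ : (Fin (n + 1) ⊕ Fin (n + 5)) ⊕ Fin (n + 1) => ℝ) with he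
  have hfac : cplRestrict a n = e ∘ fun (ζ : Src) j => ζ (ι j) := by
    funext ζ
    rfl
  have hmeas : Measurable fun (ζ : Src) (j : (Fin (n + 1) ⊕ Fin (n + 5)) ⊕ Fin (n + 1)) => ζ (ι j) :=
    measurable_pi_lambda _ fun j => measurable_pi_apply _
  have hflat : (noiseMeasure ω₂).map (fun (ζ : Src) j => ζ (ι j)) = Measure.pi μJ := by
    unfold noiseMeasure
    rw [Measure.map_infinitePi_infinitePi_of_inj (flatIdx_injective a n), Measure.infinitePi_eq_pi]
  have he_mp : MeasurePreserving e (Measure.pi μJ)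
      (((Measure.pi fun i : Fin (n + 1) => μJ (Sum.inl (Sum.inl i))).prod
          (Measure.pi fun j : Fin (n + 5) => μJ (Sum.inl (Sum.inr j)))).prod
        (Measure.pi fun i : Fin (n + 1) => μJ (Sum.inr i))) :=
    ((measurePreserving_sumPiEquivProdPi fun i : Fin (n + 1) ⊕ Fin (n + 5) => μJ (Sum.inl i)).prod
      (MeasurePreserving.id _)).comp (measurePreserving_sumPiEquivProdPi μJ)
  have hemeas : Measurable e := he_mp.measurable
  rw [hfac, ← Measure.map_map hemeas hmeas, hflat, he_mp.map_eq]
  unfold cplMeasure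
  have hA : (fun i : Fin (n + 1) => μJ (Sum.inl (Sum.inl i))) = fun _ => gaussianReal 0 1 := by
    funext i; simp [hμJ, hι]
  have hB : (fun j : Fin (n + 5) => μJ (Sum.inl (Sum.inr j))) = fun _ => gaussianReal 0 1 := by
    funext j; simp [hμJ, hι]
  have hC : (fun i : Fin (n + 1) => μJ (Sum.inr i)) = fun _ => gaussianReal 0 (noiseVar ω₂ 1) := by
    funext i; simp [hμJ, hι]
  rw [hA, hB, hC]

/-! ### Lebesgue integrals on the box phase space as shear integrals -/

/-- Zipping positions and momenta, `(q, p) ↦ (q_i, p_i)_i`, preserves Lebesgue measure. [folklore] -/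
theorem lintegral_zip (F : (Fin (n + 1) → ℝ × ℝ) → ℝ≥0∞) (hF : Measurable F) :
    ∫⁻ z : (Fin (n + 1) → ℝ) × (Fin (n + 1) → ℝ), F (fun i => (z.1 i, z.2 i)) = ∫⁻ x, F x := by
  have h := (volume_measurePreserving_arrowProdEquivProdArrow ℝ ℝ (Fin (n + 1))).symm
  rw [← h.lintegral_comp hF]
  rfl

/-- **Change of variables**: for measurable `F ≥ 0` on the box phase space and `Φ ≥ 0` on the extras,
`∫⁻ F(cplField w) Φ(u) dw = (∫⁻ F dx) (∫⁻ Φ du)` — the momentum offset is integrated out by the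
translation invariance of Lebesgue measure in the momentum block. [folklore] -/
theorem lintegral_cplField_mul (F : (Fin (n + 1) → ℝ × ℝ) → ℝ≥0∞) (hF : Measurable F)
    (Φ : (Fin (n + 5) → ℝ) → ℝ≥0∞) (hΦ : Measurable Φ) :
    ∫⁻ w : Cpl n, F (cplField a n w) * Φ w.1.2 = (∫⁻ x, F x) * ∫⁻ u, Φ u := by
  have hFm : Measurable fun w : Cpl n => F (cplField a n w) * Φ w.1.2 :=
    (hF.comp (measurable_cplField a n)).mul (hΦ.comp (measurable_snd.comp measurable_fst))
  rw [Measure.volume_eq_prod, lintegral_prod _ hFm.aemeasurable]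
  -- the inner (momentum) integral: translate by the offset
  have hzipm : ∀ q : Fin (n + 1) → ℝ, Measurable fun p : Fin (n + 1) → ℝ => F fun i => (q i, p i) := fun q =>
    hF.comp (measurable_pi_lambda _ fun i => measurable_const.prodMk (measurable_pi_apply i))
  have inner : ∀ qu : (Fin (n + 1) → ℝ) × (Fin (n + 5) → ℝ),
      ∫⁻ p : Fin (n + 1) → ℝ, F (cplField a n (qu, p)) * Φ (qu, p).1.2 =
        (∫⁻ p : Fin (n + 1) → ℝ, F fun i => (qu.1 i, p i)) * Φ qu.2 := by
    intro qu
    have e1 : (fun p : Fin (n + 1) → ℝ => F (cplField a n (qu, p)) * Φ (qu, p).1.2) =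
        fun p => (fun p' : Fin (n + 1) → ℝ => F fun i => (qu.1 i, p' i)) (p + cplShift a n qu) * Φ qu.2 := by
      funext p; rfl
    have hm : Measurable fun p : Fin (n + 1) → ℝ =>
        (fun p' : Fin (n + 1) → ℝ => F fun i => (qu.1 i, p' i)) (p + cplShift a n qu) :=
      (hzipm qu.1).comp (measurable_id.add_const _)
    rw [e1, lintegral_mul_const (Φ qu.2) hm]
    congr 1
    exact lintegral_add_right_eq_self (μ := (volume : Measure (Fin (n + 1) → ℝ)))
      (fun p : Fin (n + 1) → ℝ => F fun i => (qu.1 i, p i)) (cplShift a n qu)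
  simp_rw [inner]
  -- Tonelli on (positions × extras)
  have hzm : Measurable fun z : (Fin (n + 1) → ℝ) × (Fin (n + 1) → ℝ) => F fun i => (z.1 i, z.2 i) :=
    hF.comp (measurable_pi_lambda _ fun i =>
      ((measurable_pi_apply i).comp measurable_fst).prodMk ((measurable_pi_apply i).comp measurable_snd))
  have hKm : Measurable fun q : Fin (n + 1) → ℝ => ∫⁻ p : Fin (n + 1) → ℝ, F fun i => (q i, p i) :=
    Measurable.lintegral_prod_right' (f := fun z : (Fin (n + 1) → ℝ) × (Fin (n + 1) → ℝ) =>
      F fun i => (z.1 i, z.2 i)) hzm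
  rw [Measure.volume_eq_prod, lintegral_prod_mul hKm.aemeasurable hΦ.aemeasurable]
  congr 1
  rw [← lintegral_zip n F hF, Measure.volume_eq_prod, lintegral_prod _ hzm.aemeasurable]

/-! ### The density of the coupling law -/

/-- The coupling law has the product Gaussian density
`(∏ φ₁(q_i)) (∏ φ₁(u_j)) (∏ φ_{v₁}(e_i))` with respect to Lebesgue measure (`v₁ = noiseVar ω₂ 1 ≠ 0`).
[folklore] -/
theorem cplMeasure_eq_withDensity (hω : 0 < ω₂) :
    cplMeasure ω₂ n = (volume : Measure (Cpl n)).withDensity fun w =>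
      ENNReal.ofReal (∏ i, gaussianPDFReal 0 1 (w.1.1 i)) * ENNReal.ofReal (∏ j, gaussianPDFReal 0 1 (w.1.2 j)) *
        ENNReal.ofReal (∏ i, gaussianPDFReal 0 (noiseVar ω₂ 1) (w.2 i)) := by
  have hv : noiseVar ω₂ 1 ≠ 0 := by simp [noiseVar, hω]
  unfold cplMeasure
  have hm2 : Measurable fun z : (Fin (n + 1) → ℝ) × (Fin (n + 5) → ℝ) =>
      ENNReal.ofReal (∏ i, gaussianPDFReal 0 (1 : ℝ≥0) (z.1 i)) * ENNReal.ofReal (∏ i, gaussianPDFReal 0 (1 : ℝ≥0) (z.2 i)) :=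
    ((measurable_ofReal_prod_gaussianPDFReal _).comp measurable_fst).mul
      ((measurable_ofReal_prod_gaussianPDFReal _).comp measurable_snd)
  rw [pi_gaussianReal_eq_withDensity_prod (fun _ : Fin (n + 1) => (1 : ℝ≥0)) (fun _ => one_ne_zero),
    pi_gaussianReal_eq_withDensity_prod (fun _ : Fin (n + 5) => (1 : ℝ≥0)) (fun _ => one_ne_zero),
    pi_gaussianReal_eq_withDensity_prod (fun _ : Fin (n + 1) => noiseVar ω₂ 1) (fun _ => hv),
    prod_withDensity (measurable_ofReal_prod_gaussianPDFReal _) (measurable_ofReal_prod_gaussianPDFReal _),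
    prod_withDensity hm2 (measurable_ofReal_prod_gaussianPDFReal _)]
  rfl

end Summit.AtomisticToContinuum.FouriersLaw.Theorems.ParityLiouvilleSeed.HarmonicWitness

end
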